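import Summits.ResolutionOfSingularities.ResolutionOfSingularities.Theorems.FrobeniusLadderFInjectiveMacaulayficationClosedCentreDimEq3
import Summits.ResolutionOfSingularities.ResolutionOfSingularities.Theorems.FrobeniusLadderFInjectiveMacaulayficationFCForallExistsRungs
import HarnessLib.Audit
import HarnessLib

/-!
# #4β SPLIT BY DIMENSION: `ClosedCentreExistsDimLe2`, the threefold rung (tree), the residual `ClosedCentreExistsDimGe4`, and the splitter
# (crux `FInjectiveMacaulayfication` stmt-ResolutionOfSingularities-15315, chain w45a; door v31 stub `stub_closedCentreExists`; plan-1 R16.28 (A1))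

[OURS · L1 W4.5a · res-L1-w45a-lead-1] Support file (`--supports stmt-ResolutionOfSingularities-15315 --as helper`); NOT a statement of any
manuscript; AI-written, weaker than expert review; no named fact introduced.  The door's closed-point stub #4β (`stub_closedCentreExists`, text =
`SliceableCentre.ClosedCentreExists` expanded) is split by `dim X₁` exactly as the non-closed stub FC″ was (`FCUnguardedRungs`): dimension
`≤ 2` (`ClosedCentreExistsDimLe2` — the AFFINE case is the tree theorem `TameWildSplit.closedCentreExistsAffineDimLe2_of_lipman`; the general
case is the de-affinization object (A2)), dimension `3` (`ClosedCentreDimEq3.ClosedCentreExistsDimEq3`, PROVED modulo CP 2019 ×2 + Stacks 081R: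
`closedCentreExistsDimEq3_of_cp`, p546xxx), and the RESIDUAL `ClosedCentreExistsDimGe4` (dimension `≥ 4` — contains the d = 4 closed-point
CORE of the crux).  The split is exhaustive (`FCForallExistsRungs.dim_trichotomy`).

* `ClosedCentreExistsDimLe2`, `ClosedCentreExistsDimGe4` — #4β's text VERBATIM (as in `ClosedCentreExistsDimEq3`) with `topologicalKrullDim X₁ ≤ 2 →`,
  resp. `4 ≤ topologicalKrullDim X₁ →`, inserted after `IsIntegral X₁`;
* `closedCentreExists_of_rungs : ClosedCentreExistsDimLe2 → ClosedCentreExistsDimEq3 → ClosedCentreExistsDimGe4 → #4β` (expanded text, =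
  the door's `stub_closedCentreExists` token for token) and `rungs_of_closedCentreExists` (each rung is a weakening);
* `closedCentreExists_of_dimLe2_dimGe4 (hG) (h081R) (hP) : ClosedCentreExistsDimLe2 → ClosedCentreExistsDimGe4 → #4β` — the threefold rung discharged
  by name.
-/

-- single-problem summit: the doubled namespace component is forced
set_option linter.dupNamespace false
set_option autoImplicit false

noncomputable section

open CategoryTheory AlgebraicGeometry
open Literature.AlgebraicGeometry.Resolution

namespace Summit.ResolutionOfSingularities.ResolutionOfSingularities.Theorems.FInjectiveMacaulayfication.ClosedCentreRungs

open Summit.ResolutionOfSingularities.ResolutionOfSingularities.Theorems.FInjectiveMacaulayfication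

/-- [OURS · candidate statement] **#4β in dimension ≤ 2** — the text of door v31's `stub_closedCentreExists` (= `ClosedCentreDimEq3.ClosedCentreExistsDimEq3`
without its dimension clause) VERBATIM with `topologicalKrullDim X₁ ≤ 2 →` inserted after `IsIntegral X₁`.  Known for AFFINE `X₁` modulo Lipman 1978
(`TameWildSplit.closedCentreExistsAffineDimLe2_of_lipman`); the general (separated, finite type) case is the de-affinization object of plan-1 R16.28 (A2).
[candidate statement, OURS] -/
@[conjecture] def ClosedCentreExistsDimLe2 : Prop :=
    ∀ (p : ℕ), p.Prime → ∀ (k : Type) [Field k] [CharP k p] (X₁ : Scheme.{0}) (f₁ : X₁ ⟶ Spec (.of k)),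
    IsSeparated f₁ → LocallyOfFiniteType f₁ → QuasiCompact f₁ → IsIntegral X₁ → topologicalKrullDim X₁ ≤ 2 →
    (∀ x : X₁, ∀ d : ℕ, ringKrullDim (X₁.presheaf.stalk x) = d → ∀ s : Fin d → X₁.presheaf.stalk x, (Ideal.span (Set.range s)).radical.IsMaximal → RingTheory.Sequence.IsWeaklyRegular (X₁.presheaf.stalk x) (List.ofFn s)) →
    Set.Finite {x : X₁ | ¬ ∀ d : ℕ, ringKrullDim (X₁.presheaf.stalk x) = d → ∀ s : Fin d → X₁.presheaf.stalk x, (Ideal.span (Set.range s)).radical.IsMaximal → ∀ y : X₁.presheaf.stalk x, (∃ e : ℕ, y ^ p ^ e ∈ Ideal.span ((fun z : X₁.presheaf.stalk x => z ^ p ^ e) '' (Ideal.span (Set.range s) : Set (X₁.presheaf.stalk x)))) → y ∈ Ideal.span (Set.range s)} →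
    ∀ b : X₁, IsClosed ({b} : Set X₁) → (¬ ∀ d : ℕ, ringKrullDim (X₁.presheaf.stalk b) = d → ∀ s : Fin d → X₁.presheaf.stalk b, (Ideal.span (Set.range s)).radical.IsMaximal → ∀ y : X₁.presheaf.stalk b, (∃ e : ℕ, y ^ p ^ e ∈ Ideal.span ((fun z : X₁.presheaf.stalk b => z ^ p ^ e) '' (Ideal.span (Set.range s) : Set (X₁.presheaf.stalk b)))) → y ∈ Ideal.span (Set.range s)) →
      ∃ J : X₁.IdealSheafData, J ≠ ⊥ ∧ b ∈ (J.support : Set X₁) ∧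
        ∀ (X' : Scheme.{0}) (π : X' ⟶ X₁), Literature.AlgebraicGeometry.Resolution.IsBlowup π J →
          ∀ x' : X', π.base x' ∈ (J.support : Set X₁) → IsDomain (X'.presheaf.stalk x') ∧ ∀ d : ℕ, ringKrullDim (X'.presheaf.stalk x') = d → ∀ s : Fin d → X'.presheaf.stalk x', (Ideal.span (Set.range s)).radical.IsMaximal → RingTheory.Sequence.IsWeaklyRegular (X'.presheaf.stalk x') (List.ofFn s) ∧ ∀ y : X'.presheaf.stalk x', (∃ e : ℕ, y ^ p ^ e ∈ Ideal.span ((fun z : X'.presheaf.stalk x' => z ^ p ^ e) '' (Ideal.span (Set.range s) : Set (X'.presheaf.stalk x')))) → y ∈ Ideal.span (Set.range s)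


/-- [OURS · candidate statement, the RESIDUAL] **#4β in dimension ≥ 4** — the same text with `4 ≤ topologicalKrullDim X₁ →` inserted after
`IsIntegral X₁`: at a bad closed point of an admissible integral Cohen–Macaulay `X₁` of dimension ≥ 4 with finitely many non-F-injective points
there is a non-zero ideal sheaf through it all of whose blowing ups are FULL over its support.  This CONTAINS the d = 4 closed-point core of the
crux (plan-1 R16.24 (3)); nothing in the tree bears on it beyond the engine instances (F008 ✓, F192 ✓, E7/E8/T₁₁ specimens). [candidate statement, OURS] -/
@[conjecture] def ClosedCentreExistsDimGe4 : Prop :=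
    ∀ (p : ℕ), p.Prime → ∀ (k : Type) [Field k] [CharP k p] (X₁ : Scheme.{0}) (f₁ : X₁ ⟶ Spec (.of k)),
    IsSeparated f₁ → LocallyOfFiniteType f₁ → QuasiCompact f₁ → IsIntegral X₁ → 4 ≤ topologicalKrullDim X₁ →
    (∀ x : X₁, ∀ d : ℕ, ringKrullDim (X₁.presheaf.stalk x) = d → ∀ s : Fin d → X₁.presheaf.stalk x, (Ideal.span (Set.range s)).radical.IsMaximal → RingTheory.Sequence.IsWeaklyRegular (X₁.presheaf.stalk x) (List.ofFn s)) →
    Set.Finite {x : X₁ | ¬ ∀ d : ℕ, ringKrullDim (X₁.presheaf.stalk x) = d → ∀ s : Fin d → X₁.presheaf.stalk x, (Ideal.span (Set.range s)).radical.IsMaximal → ∀ y : X₁.presheaf.stalk x, (∃ e : ℕ, y ^ p ^ e ∈ Ideal.span ((fun z : X₁.presheaf.stalk x => z ^ p ^ e) '' (Ideal.span (Set.range s) : Set (X₁.presheaf.stalk x)))) → y ∈ Ideal.span (Set.range s)} →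
    ∀ b : X₁, IsClosed ({b} : Set X₁) → (¬ ∀ d : ℕ, ringKrullDim (X₁.presheaf.stalk b) = d → ∀ s : Fin d → X₁.presheaf.stalk b, (Ideal.span (Set.range s)).radical.IsMaximal → ∀ y : X₁.presheaf.stalk b, (∃ e : ℕ, y ^ p ^ e ∈ Ideal.span ((fun z : X₁.presheaf.stalk b => z ^ p ^ e) '' (Ideal.span (Set.range s) : Set (X₁.presheaf.stalk b)))) → y ∈ Ideal.span (Set.range s)) →
      ∃ J : X₁.IdealSheafData, J ≠ ⊥ ∧ b ∈ (J.support : Set X₁) ∧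
        ∀ (X' : Scheme.{0}) (π : X' ⟶ X₁), Literature.AlgebraicGeometry.Resolution.IsBlowup π J →
          ∀ x' : X', π.base x' ∈ (J.support : Set X₁) → IsDomain (X'.presheaf.stalk x') ∧ ∀ d : ℕ, ringKrullDim (X'.presheaf.stalk x') = d → ∀ s : Fin d → X'.presheaf.stalk x', (Ideal.span (Set.range s)).radical.IsMaximal → RingTheory.Sequence.IsWeaklyRegular (X'.presheaf.stalk x') (List.ofFn s) ∧ ∀ y : X'.presheaf.stalk x', (∃ e : ℕ, y ^ p ^ e ∈ Ideal.span ((fun z : X'.presheaf.stalk x' => z ^ p ^ e) '' (Ideal.span (Set.range s) : Set (X'.presheaf.stalk x')))) → y ∈ Ideal.span (Set.range s)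


/-- **THE SPLITTER: #4β ⇐ #4β(dim ≤ 2) + #4β(dim 3) + #4β(dim ≥ 4)** — exhaustive by `FCForallExistsRungs.dim_trichotomy (topologicalKrullDim X₁)`.
The conclusion is #4β's text VERBATIM (door v31 `stub_closedCentreExists`). [plumbing] -/
theorem closedCentreExists_of_rungs (h2 : ClosedCentreExistsDimLe2) (h3 : ClosedCentreDimEq3.ClosedCentreExistsDimEq3)
    (h4 : ClosedCentreExistsDimGe4) :
    ∀ (p : ℕ), p.Prime → ∀ (k : Type) [Field k] [CharP k p] (X₁ : Scheme.{0}) (f₁ : X₁ ⟶ Spec (.of k)),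
    IsSeparated f₁ → LocallyOfFiniteType f₁ → QuasiCompact f₁ → IsIntegral X₁ →
    (∀ x : X₁, ∀ d : ℕ, ringKrullDim (X₁.presheaf.stalk x) = d → ∀ s : Fin d → X₁.presheaf.stalk x, (Ideal.span (Set.range s)).radical.IsMaximal → RingTheory.Sequence.IsWeaklyRegular (X₁.presheaf.stalk x) (List.ofFn s)) →
    Set.Finite {x : X₁ | ¬ ∀ d : ℕ, ringKrullDim (X₁.presheaf.stalk x) = d → ∀ s : Fin d → X₁.presheaf.stalk x, (Ideal.span (Set.range s)).radical.IsMaximal → ∀ y : X₁.presheaf.stalk x, (∃ e : ℕ, y ^ p ^ e ∈ Ideal.span ((fun z : X₁.presheaf.stalk x => z ^ p ^ e) '' (Ideal.span (Set.range s) : Set (X₁.presheaf.stalk x)))) → y ∈ Ideal.span (Set.range s)} →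
    ∀ b : X₁, IsClosed ({b} : Set X₁) → (¬ ∀ d : ℕ, ringKrullDim (X₁.presheaf.stalk b) = d → ∀ s : Fin d → X₁.presheaf.stalk b, (Ideal.span (Set.range s)).radical.IsMaximal → ∀ y : X₁.presheaf.stalk b, (∃ e : ℕ, y ^ p ^ e ∈ Ideal.span ((fun z : X₁.presheaf.stalk b => z ^ p ^ e) '' (Ideal.span (Set.range s) : Set (X₁.presheaf.stalk b)))) → y ∈ Ideal.span (Set.range s)) →
      ∃ J : X₁.IdealSheafData, J ≠ ⊥ ∧ b ∈ (J.support : Set X₁) ∧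
        ∀ (X' : Scheme.{0}) (π : X' ⟶ X₁), Literature.AlgebraicGeometry.Resolution.IsBlowup π J →
          ∀ x' : X', π.base x' ∈ (J.support : Set X₁) → IsDomain (X'.presheaf.stalk x') ∧ ∀ d : ℕ, ringKrullDim (X'.presheaf.stalk x') = d → ∀ s : Fin d → X'.presheaf.stalk x', (Ideal.span (Set.range s)).radical.IsMaximal → RingTheory.Sequence.IsWeaklyRegular (X'.presheaf.stalk x') (List.ofFn s) ∧ ∀ y : X'.presheaf.stalk x', (∃ e : ℕ, y ^ p ^ e ∈ Ideal.span ((fun z : X'.presheaf.stalk x' => z ^ p ^ e) '' (Ideal.span (Set.range s) : Set (X'.presheaf.stalk x')))) → y ∈ Ideal.span (Set.range s) := by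
  intro p hp k _ _ X₁ f₁ hs hl hq hi
  rcases FCForallExistsRungs.dim_trichotomy (topologicalKrullDim X₁) with hd | hd | hd
  · exact h2 p hp k X₁ f₁ hs hl hq hi hd
  · exact h3 p hp k X₁ f₁ hs hl hq hi hd
  · exact h4 p hp k X₁ f₁ hs hl hq hi hd

/-- Sanity: each rung is a weakening of #4β (an honest case split). [plumbing] -/
theorem rungs_of_closedCentreExists
    (h :
    ∀ (p : ℕ), p.Prime → ∀ (k : Type) [Field k] [CharP k p] (X₁ : Scheme.{0}) (f₁ : X₁ ⟶ Spec (.of k)),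
    IsSeparated f₁ → LocallyOfFiniteType f₁ → QuasiCompact f₁ → IsIntegral X₁ →
    (∀ x : X₁, ∀ d : ℕ, ringKrullDim (X₁.presheaf.stalk x) = d → ∀ s : Fin d → X₁.presheaf.stalk x, (Ideal.span (Set.range s)).radical.IsMaximal → RingTheory.Sequence.IsWeaklyRegular (X₁.presheaf.stalk x) (List.ofFn s)) →
    Set.Finite {x : X₁ | ¬ ∀ d : ℕ, ringKrullDim (X₁.presheaf.stalk x) = d → ∀ s : Fin d → X₁.presheaf.stalk x, (Ideal.span (Set.range s)).radical.IsMaximal → ∀ y : X₁.presheaf.stalk x, (∃ e : ℕ, y ^ p ^ e ∈ Ideal.span ((fun z : X₁.presheaf.stalk x => z ^ p ^ e) '' (Ideal.span (Set.range s) : Set (X₁.presheaf.stalk x)))) → y ∈ Ideal.span (Set.range s)} →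
    ∀ b : X₁, IsClosed ({b} : Set X₁) → (¬ ∀ d : ℕ, ringKrullDim (X₁.presheaf.stalk b) = d → ∀ s : Fin d → X₁.presheaf.stalk b, (Ideal.span (Set.range s)).radical.IsMaximal → ∀ y : X₁.presheaf.stalk b, (∃ e : ℕ, y ^ p ^ e ∈ Ideal.span ((fun z : X₁.presheaf.stalk b => z ^ p ^ e) '' (Ideal.span (Set.range s) : Set (X₁.presheaf.stalk b)))) → y ∈ Ideal.span (Set.range s)) →
      ∃ J : X₁.IdealSheafData, J ≠ ⊥ ∧ b ∈ (J.support : Set X₁) ∧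
        ∀ (X' : Scheme.{0}) (π : X' ⟶ X₁), Literature.AlgebraicGeometry.Resolution.IsBlowup π J →
          ∀ x' : X', π.base x' ∈ (J.support : Set X₁) → IsDomain (X'.presheaf.stalk x') ∧ ∀ d : ℕ, ringKrullDim (X'.presheaf.stalk x') = d → ∀ s : Fin d → X'.presheaf.stalk x', (Ideal.span (Set.range s)).radical.IsMaximal → RingTheory.Sequence.IsWeaklyRegular (X'.presheaf.stalk x') (List.ofFn s) ∧ ∀ y : X'.presheaf.stalk x', (∃ e : ℕ, y ^ p ^ e ∈ Ideal.span ((fun z : X'.presheaf.stalk x' => z ^ p ^ e) '' (Ideal.span (Set.range s) : Set (X'.presheaf.stalk x')))) → y ∈ Ideal.span (Set.range s)) :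
    ClosedCentreExistsDimLe2 ∧ ClosedCentreDimEq3.ClosedCentreExistsDimEq3 ∧ ClosedCentreExistsDimGe4 :=
  ⟨fun p hp k _ _ X₁ f₁ hs hl hq hi _ => h p hp k X₁ f₁ hs hl hq hi,
    fun p hp k _ _ X₁ f₁ hs hl hq hi _ => h p hp k X₁ f₁ hs hl hq hi,
    fun p hp k _ _ X₁ f₁ hs hl hq hi _ => h p hp k X₁ f₁ hs hl hq hi⟩

/-- **#4β from its dimension-≤-2 rung and its dimension-≥-4 residual**, the threefold rung being the tree theorem
`ClosedCentreDimEq3.closedCentreExistsDimEq3_of_cp` (Cossart–Piltant 2019 Thm. 1.1 (i)(ii), Raynaud–Gruson flattening, CP 2019 Prop. 4.4, BY NAME).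
[OURS assembly] [cite: CossartPiltant2019, Thm. 1.1 (i)(ii); Prop. 4.4] [cite: StacksProject, Tag 081T] -/
theorem closedCentreExists_of_dimLe2_dimGe4
    (hG : CossartPiltant2019General.{0}) (h081R : Stacks081R.{0}) (hP : CossartPiltant2019Principalization.{0})
    (h2 : ClosedCentreExistsDimLe2) (h4 : ClosedCentreExistsDimGe4) :
    ∀ (p : ℕ), p.Prime → ∀ (k : Type) [Field k] [CharP k p] (X₁ : Scheme.{0}) (f₁ : X₁ ⟶ Spec (.of k)),
    IsSeparated f₁ → LocallyOfFiniteType f₁ → QuasiCompact f₁ → IsIntegral X₁ →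
    (∀ x : X₁, ∀ d : ℕ, ringKrullDim (X₁.presheaf.stalk x) = d → ∀ s : Fin d → X₁.presheaf.stalk x, (Ideal.span (Set.range s)).radical.IsMaximal → RingTheory.Sequence.IsWeaklyRegular (X₁.presheaf.stalk x) (List.ofFn s)) →
    Set.Finite {x : X₁ | ¬ ∀ d : ℕ, ringKrullDim (X₁.presheaf.stalk x) = d → ∀ s : Fin d → X₁.presheaf.stalk x, (Ideal.span (Set.range s)).radical.IsMaximal → ∀ y : X₁.presheaf.stalk x, (∃ e : ℕ, y ^ p ^ e ∈ Ideal.span ((fun z : X₁.presheaf.stalk x => z ^ p ^ e) '' (Ideal.span (Set.range s) : Set (X₁.presheaf.stalk x)))) → y ∈ Ideal.span (Set.range s)} →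
    ∀ b : X₁, IsClosed ({b} : Set X₁) → (¬ ∀ d : ℕ, ringKrullDim (X₁.presheaf.stalk b) = d → ∀ s : Fin d → X₁.presheaf.stalk b, (Ideal.span (Set.range s)).radical.IsMaximal → ∀ y : X₁.presheaf.stalk b, (∃ e : ℕ, y ^ p ^ e ∈ Ideal.span ((fun z : X₁.presheaf.stalk b => z ^ p ^ e) '' (Ideal.span (Set.range s) : Set (X₁.presheaf.stalk b)))) → y ∈ Ideal.span (Set.range s)) →
      ∃ J : X₁.IdealSheafData, J ≠ ⊥ ∧ b ∈ (J.support : Set X₁) ∧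
        ∀ (X' : Scheme.{0}) (π : X' ⟶ X₁), Literature.AlgebraicGeometry.Resolution.IsBlowup π J →
          ∀ x' : X', π.base x' ∈ (J.support : Set X₁) → IsDomain (X'.presheaf.stalk x') ∧ ∀ d : ℕ, ringKrullDim (X'.presheaf.stalk x') = d → ∀ s : Fin d → X'.presheaf.stalk x', (Ideal.span (Set.range s)).radical.IsMaximal → RingTheory.Sequence.IsWeaklyRegular (X'.presheaf.stalk x') (List.ofFn s) ∧ ∀ y : X'.presheaf.stalk x', (∃ e : ℕ, y ^ p ^ e ∈ Ideal.span ((fun z : X'.presheaf.stalk x' => z ^ p ^ e) '' (Ideal.span (Set.range s) : Set (X'.presheaf.stalk x')))) → y ∈ Ideal.span (Set.range s) :=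
  closedCentreExists_of_rungs h2 (ClosedCentreDimEq3.closedCentreExistsDimEq3_of_cp hG h081R hP) h4

end Summit.ResolutionOfSingularities.ResolutionOfSingularities.Theorems.FInjectiveMacaulayfication.ClosedCentreRungs

end
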